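import Summits.ResolutionOfSingularities.ResolutionOfSingularities.Theorems.TameTwoStoreyLU2
import HarnessLib

/-!
# TameTwoStoreyLU3 — the `K_T`-frame `exists_galFrame` and STEP E `exists_descended_model_of_inert` (ENGINE-2 along the inert storey `H = G/T`)

One of the landing files of the g29 node «TameTwoStorey» of the ROOT/RESIDUAL decomposition cell `decomp-res` (lens 1,
window (W-α) WHOLE; files `TameTwoStoreyLU`, `…LU1B`, `…LU2` (landed), `…LU3`–`…LU8`); see the module docstring of
`Summits.ResolutionOfSingularities.ResolutionOfSingularities.Theorems.TameTwoStoreyLU` for the thesis, the cell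
`TameOverInertLUAbove k O` (in `…LU2`), the law `relLU_of_tameOverInertLUAbove : TameOverInertLUAbove k O →
RelLocalUniformization k K O` (in `…LU7`), the paper instances and the sources.  This file: `exists_galFrame` (the finite group `H′ = G|_{K_T}` of a `G`-stable subfield with its fixed subfield `K₀ = K_T^G`, mul-closed, containing `1`, `O′`-stable, lifting to / covering `G`) and STEP E of the law.
Imports: the landed `…TameTwoStoreyLU2` only.  Problem side, sorry-free, hypothesis-free; every heavy theorem carries
`set_option maxHeartbeats … in` BEFORE its docstring — keep it.
-/

noncomputable section

open IsLocalRing Polynomial IntermediateField Literature.AlgebraicGeometry.Resolution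
open Summit.ResolutionOfSingularities.ResolutionOfSingularities.Theorems.TameQuotientLU
open Summit.ResolutionOfSingularities.ResolutionOfSingularities.Theorems.TameAbelianQuotientLU
open Summit.ResolutionOfSingularities.ResolutionOfSingularities.Theorems.InertiaIsotypicStability
open Summit.ResolutionOfSingularities.ResolutionOfSingularities.Theorems.TameInertialLU
open Summit.ResolutionOfSingularities.ResolutionOfSingularities.Theorems.TameAbelianMonomialChart

namespace Summit.ResolutionOfSingularities.ResolutionOfSingularities.Theorems.TameTwoStoreyLU

universe u

section Law

variable (k : Type) [Field k] {K : Type} [Field K] [Algebra k K]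

variable {k}

/-- **The `K_T`-frame of the inert storey** (generic; used by STEPS C and E of the two-storey law).  For a finite
extension `K′/K`, a subfield `K_T ⊆ K′` stable under `G = Aut(K′/K)` and a `G`-stable valuation ring `O′`: the
finite set `H′ = G|_{K_T}` of restricted automorphisms (`StableRestrict.imageRestrict`) contains `1`, is closed
under products, its common fixed subfield `K₀ ⊆ K_T` is exactly the set of `G`-fixed elements of `K_T`, every
member of `H′` is the restriction of some `g ∈ G` and conversely, and `H′` preserves `O′ ∩ K_T`. [folklore] -/
theorem exists_galFrame {K' : Type} [Field K'] [Algebra K K'] [FiniteDimensional K K'] (KT : Subfield K')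
    (hGKT : ∀ (g : K' ≃ₐ[K] K') (z : K'), z ∈ KT ↔ g z ∈ KT) (O' : ValuationSubring K')
    (hGO' : ∀ (g : K' ≃ₐ[K] K') (y : K'), y ∈ O' ↔ g y ∈ O') :
    ∃ (H' : Finset (KT ≃+* KT)) (K₀ : Subfield KT), (1 : KT ≃+* KT) ∈ H' ∧
      (∀ a ∈ H', ∀ b ∈ H', a * b ∈ H') ∧ (∀ w : KT, w ∈ K₀ ↔ ∀ h ∈ H', h w = w) ∧
      (∀ w : KT, w ∈ K₀ ↔ ∀ g : K' ≃ₐ[K] K', g (w : K') = w) ∧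
      (∀ h ∈ H', ∃ g : K' ≃ₐ[K] K', ∀ w : KT, ((h w : KT) : K') = g w) ∧
      (∀ g : K' ≃ₐ[K] K', ∃ h ∈ H', ∀ w : KT, ((h w : KT) : K') = g w) ∧
      (∀ h ∈ H', ∀ w : KT, w ∈ O'.comap KT.subtype ↔ h w ∈ O'.comap KT.subtype) := by
  classical
  let Gfin : Finset (K' ≃+* K') := Finset.univ.image fun g : K' ≃ₐ[K] K' => (g : K' ≃+* K')
  have hGfin : ∀ g' ∈ Gfin, ∃ g : K' ≃ₐ[K] K', (g : K' ≃+* K') = g' := fun g' hg' => by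
    obtain ⟨g, -, hg⟩ := Finset.mem_image.mp hg'
    exact ⟨g, hg⟩
  have hmemGfin : ∀ g : K' ≃ₐ[K] K', (g : K' ≃+* K') ∈ Gfin := fun g =>
    Finset.mem_image.mpr ⟨g, Finset.mem_univ _, rfl⟩
  have hcoe1 : ((1 : K' ≃ₐ[K] K') : K' ≃+* K') = 1 := RingEquiv.ext fun _ => rfl
  have hcoemul : ∀ g g' : K' ≃ₐ[K] K', ((g * g' : K' ≃ₐ[K] K') : K' ≃+* K') =
      (g : K' ≃+* K') * (g' : K' ≃+* K') := fun _ _ => RingEquiv.ext fun _ => rfl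
  have h1G : (1 : K' ≃+* K') ∈ Gfin := hcoe1 ▸ hmemGfin 1
  have hmulG : ∀ a ∈ Gfin, ∀ b ∈ Gfin, a * b ∈ Gfin := by
    intro a ha b hb
    obtain ⟨g, rfl⟩ := hGfin a ha
    obtain ⟨g', rfl⟩ := hGfin b hb
    rw [← hcoemul]
    exact hmemGfin _
  have hGst : ∀ g ∈ Gfin, ∀ x, x ∈ KT ↔ g x ∈ KT := by
    intro g' hg' x
    obtain ⟨g, rfl⟩ := hGfin g' hg'
    exact hGKT g x
  let H' : Finset (KT ≃+* KT) := StableRestrict.imageRestrict KT Gfin hGst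
  have h1H : (1 : KT ≃+* KT) ∈ H' := StableRestrict.one_mem_imageRestrict hGst h1G
  have hmulH : ∀ a ∈ H', ∀ b ∈ H', a * b ∈ H' := StableRestrict.mul_mem_imageRestrict hGst hmulG
  let K₀ : Subfield KT :=
    (IntermediateField.fixedField (⊤ : Subgroup (K' ≃ₐ[K] K'))).toSubfield.comap KT.subtype
  have hK₀ : ∀ w : KT, w ∈ K₀ ↔ ∀ g : K' ≃ₐ[K] K', g (w : K') = w := by
    intro w
    show w ∈ K₀ ↔ _
    rw [Subfield.mem_comap, IntermediateField.mem_toSubfield, IntermediateField.mem_fixedField_iff]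
    exact ⟨fun hw g => hw g (Subgroup.mem_top g), fun hw g _ => hw g⟩
  have hK : ∀ w : KT, w ∈ K₀ ↔ ∀ h ∈ H', h w = w := by
    intro w
    rw [hK₀, StableRestrict.forall_imageRestrict_apply_eq_iff hGst w]
    constructor
    · intro hw g' hg'
      obtain ⟨g, rfl⟩ := hGfin g' hg'
      exact hw g
    · intro hw g
      exact hw _ (hmemGfin g)
  have hH'G : ∀ h ∈ H', ∃ g : K' ≃ₐ[K] K', ∀ w : KT, ((h w : KT) : K') = g w := by
    intro h hh
    obtain ⟨g', hg', rfl⟩ := StableRestrict.mem_imageRestrict_iff.mp hh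
    obtain ⟨g, rfl⟩ := hGfin g' hg'
    exact ⟨g, fun w => rfl⟩
  have hGH' : ∀ g : K' ≃ₐ[K] K', ∃ h ∈ H', ∀ w : KT, ((h w : KT) : K') = g w := fun g =>
    ⟨StableRestrict.restrict KT (g : K' ≃+* K') (hGst _ (hmemGfin g)),
      StableRestrict.restrict_mem_imageRestrict hGst (hmemGfin g), fun w => rfl⟩
  have hHO : ∀ h ∈ H', ∀ w : KT, w ∈ O'.comap KT.subtype ↔ h w ∈ O'.comap KT.subtype := by
    refine (StableRestrict.forall_mem_imageRestrict_iff).mpr fun g' hg' w => ?_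
    obtain ⟨g, rfl⟩ := hGfin g' hg'
    rw [StableRestrict.mem_comap_subtype_iff, StableRestrict.mem_comap_subtype_iff,
      StableRestrict.coe_restrict_apply]
    exact hGO' g w
  exact ⟨H', K₀, h1H, hmulH, hK, hK₀, hH'G, hGH', hHO⟩

set_option maxHeartbeats 2000000 in
/-- **STEP E of the two-storey law — DESCENT ALONG THE INERT STOREY `H = G/T` (ENGINE-2 in the `K_T`-frame).**
`K′/K` finite Galois, `O′` `G`-stable, `T ≤ G` any subgroup with fixed field `K_T ∋ ι(K)`, `x_s ∈ K_T` a
`T`-separator (`Stab_G(x_s) ⊆ T`) separating `H′ = G|_{K_T}` residually (`v(x_s − h x_s) = 1`, `h ≠ 1`), `K₀`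
the `G`-fixed part of `K_T` (`exists_galFrame`), `S′ ⊆ K_T` a Noetherian `G`-fixed base through which `ι(K)`
is fractions.  If `T₁ = S′[tt] ⊆ O′ ∩ K_T` is `G`-stable, contains `x_s` and `locAtCentre T₁ O′` is regular, then
`T₁ ∩ ι(K) = S′[t_K]` for a finite `t_K ⊆ ι(K)` and `locAtCentre (S′[t_K]) O′` is regular: ENGINE-2
`InvariantDescentLU.isRegularLocalRing_locAtCentre_inf_fixed_of_fg` + `exists_finset_inf_fixed_eq_closure`
read inside `K_T` (`StableRestrict.isRegularLocalRing_locAtCentre_comap_iff`, `map_locAtCentre_comap`), with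
`K_T = ι(K)(x_s)` by the Galois correspondence (`exists_aeval_eq_of_fixed`) and `Frac T₁ = K_T`.
[cite: CossartPiltant2019, Prop. 4.10] [folklore: Artin–Tate, Galois descent of regularity along an inert extension] -/
theorem exists_descended_model_of_inert {K' : Type} [Field K'] [Algebra K K'] [FiniteDimensional K K']
    [IsGalois K K'] {O' : ValuationSubring K'} (T : Subgroup (K' ≃ₐ[K] K')) (KT : Subfield K')
    (hKT' : ∀ z : K', z ∈ KT ↔ ∀ g ∈ T, g z = z) (hKKT : ∀ x : K, algebraMap K K' x ∈ KT)
    {xs : K'} (hxsKT : xs ∈ KT) (hfixT : ∀ g : K' ≃ₐ[K] K', g xs = xs → g ∈ T)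
    (H' : Finset (KT ≃+* KT)) (K₀ : Subfield KT) (h1H : (1 : KT ≃+* KT) ∈ H')
    (hmulH : ∀ a ∈ H', ∀ b ∈ H', a * b ∈ H') (hK : ∀ w : KT, w ∈ K₀ ↔ ∀ h ∈ H', h w = w)
    (hK₀ : ∀ w : KT, w ∈ K₀ ↔ ∀ g : K' ≃ₐ[K] K', g (w : K') = w)
    (hH'G : ∀ h ∈ H', ∃ g : K' ≃ₐ[K] K', ∀ w : KT, ((h w : KT) : K') = g w)
    (hsepE : ∀ h ∈ H', h ≠ 1 →
      (O'.comap KT.subtype).valuation ((⟨xs, hxsKT⟩ : KT) - h ⟨xs, hxsKT⟩) = 1)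
    (S' : Subring K') (hS'noeth : IsNoetherianRing S') (hS'KT : S' ≤ KT.toSubring)
    (hGS' : ∀ (g : K' ≃ₐ[K] K'), ∀ s ∈ S', g s = s)
    (hS'frac : ∀ x : K, ∃ a ∈ S', ∃ b ∈ S', algebraMap K K' x = a / b)
    (tt : Finset K') (hT₁O : Subring.closure ((S' : Set K') ∪ (tt : Set K')) ≤ O'.toSubring)
    (hT₁KT : Subring.closure ((S' : Set K') ∪ (tt : Set K')) ≤ KT.toSubring)
    (hxT₁ : xs ∈ Subring.closure ((S' : Set K') ∪ (tt : Set K')))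
    (hGT₁ : ∀ (g : K' ≃ₐ[K] K'), ∀ w ∈ Subring.closure ((S' : Set K') ∪ (tt : Set K')),
      g w ∈ Subring.closure ((S' : Set K') ∪ (tt : Set K')))
    (hT₁reg : IsRegularLocalRing (locAtCentre (Subring.closure ((S' : Set K') ∪ (tt : Set K'))) O')) :
    ∃ tK : Finset K', (tK : Set K') ⊆ Set.range (algebraMap K K' : K →+* K') ∧
      Subring.closure ((S' : Set K') ∪ (tK : Set K')) ≤ O'.toSubring ∧
      IsRegularLocalRing (locAtCentre (Subring.closure ((S' : Set K') ∪ (tK : Set K'))) O') := by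
  classical
  have hgf : ∀ (g : K' ≃ₐ[K] K') (x : K), g (algebraMap K K' x) = algebraMap K K' x :=
    fun g x => g.commutes x
  set T₁ : Subring K' := Subring.closure ((S' : Set K') ∪ (tt : Set K')) with hT₁def
  have hS'T₁ : S' ≤ T₁ := fun w hw => Subring.subset_closure (Or.inl hw)
  have httT₁ : ∀ w ∈ tt, w ∈ T₁ := fun w hw => Subring.subset_closure (Or.inr (Finset.mem_coe.mpr hw))
  let OE' : ValuationSubring KT := O'.comap KT.subtype
  have hOE' : ∀ w : KT, w ∈ OE' ↔ (w : K') ∈ O' := fun w => StableRestrict.mem_comap_subtype_iff O' KT w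
  let xE : KT := ⟨xs, hxsKT⟩
  -- the base and the model read in the frame `K_T`
  let S₀ : Subring KT := S'.comap KT.subtype
  have hS₀ : ∀ w : KT, w ∈ S₀ ↔ (w : K') ∈ S' := fun w => Subring.mem_comap
  haveI := hS'noeth
  let eqv : S' ≃+* S₀ :=
    { toFun := fun w => ⟨⟨(w : K'), hS'KT w.2⟩, (hS₀ _).mpr w.2⟩
      invFun := fun w => ⟨((w : KT) : K'), (hS₀ _).mp w.2⟩
      left_inv := fun w => Subtype.ext rfl
      right_inv := fun w => Subtype.ext (Subtype.ext rfl)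
      map_mul' := fun a b => Subtype.ext (Subtype.ext rfl)
      map_add' := fun a b => Subtype.ext (Subtype.ext rfl) }
  haveI hS₀noeth : IsNoetherianRing S₀ := isNoetherianRing_of_ringEquiv S' eqv
  have hS₀K : S₀ ≤ K₀.toSubring := fun w hw => (hK₀ w).mpr fun g => hGS' g _ ((hS₀ w).mp hw)
  let t' : Finset KT := tt.subtype (· ∈ KT)
  have ht' : ∀ w : KT, w ∈ t' ↔ (w : K') ∈ tt := fun w => Finset.mem_subtype
  set S : Subring KT := Subring.closure ((S₀ : Set KT) ∪ (t' : Set KT)) with hSdef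
  have himS₀ : (KT.subtype : KT → K') '' (S₀ : Set KT) = (S' : Set K') := by
    ext w
    constructor
    · rintro ⟨w', hw', rfl⟩
      exact (hS₀ w').mp hw'
    · intro hw
      exact ⟨⟨w, hS'KT hw⟩, (hS₀ _).mpr hw, rfl⟩
  have himt' : (KT.subtype : KT → K') '' (t' : Set KT) = (tt : Set K') := by
    ext w
    constructor
    · rintro ⟨w', hw', rfl⟩
      exact Finset.mem_coe.mpr ((ht' w').mp (Finset.mem_coe.mp hw'))
    · intro hw
      exact ⟨⟨w, hT₁KT (httT₁ w (Finset.mem_coe.mp hw))⟩,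
        Finset.mem_coe.mpr ((ht' _).mpr (Finset.mem_coe.mp hw)), rfl⟩
  have hSmap : S.map KT.subtype = T₁ := by
    rw [hSdef, RingHom.map_closure, Set.image_union, himS₀, himt', ← hT₁def]
  have hmemS : ∀ w : KT, w ∈ S ↔ (w : K') ∈ T₁ := by
    intro w
    rw [← hSmap, Subring.mem_map]
    constructor
    · intro hw
      exact ⟨w, hw, rfl⟩
    · rintro ⟨w', hw', hww⟩
      have h1 : w' = w := Subtype.ext hww
      rw [← h1]
      exact hw'
  have hSO : S ≤ OE'.toSubring := fun w hw => (hOE' w).mpr (hT₁O ((hmemS w).mp hw))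
  have hSH : ∀ h ∈ H', ∀ w ∈ S, h w ∈ S := by
    intro h hh w hw
    obtain ⟨g, hg⟩ := hH'G h hh
    rw [hmemS, hg]
    exact hGT₁ g _ ((hmemS w).mp hw)
  have hxS : xE ∈ S := (hmemS xE).mpr hxT₁
  have hregS : IsRegularLocalRing (locAtCentre S OE') := by
    show IsRegularLocalRing (locAtCentre S (O'.comap KT.subtype))
    rw [StableRestrict.isRegularLocalRing_locAtCentre_comap_iff O' KT S, hSmap]
    exact hT₁reg
  -- `K_T = K₀(x)`: every element of `K_T` is a polynomial in the separator over `ι(K)` (Galois correspondence)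
  let ιT : K →+* KT := (algebraMap K K' : K →+* K').codRestrict KT hKKT
  have hgen : ∀ w : KT, ∃ p : KT[X], (∀ i, p.coeff i ∈ K₀) ∧ w = p.eval xE := by
    intro w
    obtain ⟨q, hq⟩ := exists_aeval_eq_of_fixed T xs hfixT (w : K') ((hKT' _).mp w.2)
    refine ⟨q.map ιT, fun i => ?_, ?_⟩
    · rw [Polynomial.coeff_map, hK₀]
      intro g
      exact hgf g _
    · apply Subtype.ext
      have h1 : (KT.subtype).comp ιT = (algebraMap K K' : K →+* K') := RingHom.ext fun _ => rfl
      have h2 : ((Polynomial.eval xE (q.map ιT) : KT) : K') = Polynomial.aeval xs q := by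
        rw [Polynomial.eval_map,
          show ((Polynomial.eval₂ ιT xE q : KT) : K') = KT.subtype (Polynomial.eval₂ ιT xE q) from rfl,
          Polynomial.hom_eval₂, h1, Polynomial.aeval_def]
        rfl
      rw [h2]
      exact hq
  -- `Frac S = K_T`
  have hcoefS : ∀ c : KT, c ∈ K₀ → c ∈ Subfield.closure (S : Set KT) := by
    intro c hc
    obtain ⟨x, hx⟩ := exists_algebraMap_eq_of_fixed_all (K := K) fun g => (hK₀ c).mp hc g
    obtain ⟨a, ha, b, hb, hab⟩ := hS'frac x
    have hca : c = (⟨a, hS'KT ha⟩ : KT) / ⟨b, hS'KT hb⟩ := by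
      apply Subtype.ext
      rw [Subfield.coe_div, ← hx, hab]
    rw [hca]
    exact div_mem (Subfield.subset_closure ((hmemS _).mpr (hS'T₁ ha)))
      (Subfield.subset_closure ((hmemS _).mpr (hS'T₁ hb)))
  have hfrac : ∀ w : KT, ∃ a ∈ S, ∃ b ∈ S, b ≠ 0 ∧ w = a / b := by
    intro w
    have hF : w ∈ Subfield.closure (S : Set KT) := by
      obtain ⟨p, hp, hw⟩ := hgen w
      rw [hw, Polynomial.eval_eq_sum_range]
      exact sum_mem fun i _ => mul_mem (hcoefS _ (hp i)) (pow_mem (Subfield.subset_closure hxS) _)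
    obtain ⟨a, ha, b, hb, hab⟩ := Subfield.mem_closure_iff.mp hF
    rw [Subring.closure_eq] at ha hb
    by_cases hb0 : b = 0
    · refine ⟨0, S.zero_mem, 1, S.one_mem, one_ne_zero, ?_⟩
      rw [← hab, hb0, div_zero, zero_div]
    · exact ⟨a, ha, b, hb, hb0, hab.symm⟩
  have hregK : IsRegularLocalRing (locAtCentre (S ⊓ K₀.toSubring) OE') :=
    InvariantDescentLU.isRegularLocalRing_locAtCentre_inf_fixed_of_fg OE' H' K₀ S h1H hmulH hK hSO hSH
      hfrac hregS S₀ hS₀K t' hSdef hxS hsepE hgen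
  obtain ⟨t'', ht''sub, ht''eq⟩ :=
    InvariantDescentLU.exists_finset_inf_fixed_eq_closure H' K₀ S h1H hmulH hK hSH S₀ hS₀K t' hSdef
  -- back to `K′`: the descended model `S'[t_K]` with `t_K ⊆ ι(K)`, regular at the centre of `O′`
  let tK : Finset K' := t''.image KT.subtype
  have hT₂ : (S ⊓ K₀.toSubring).map KT.subtype = Subring.closure ((S' : Set K') ∪ (tK : Set K')) := by
    rw [ht''eq, RingHom.map_closure, Set.image_union, himS₀, Finset.coe_image]
  have hT₂reg : IsRegularLocalRing (locAtCentre (Subring.closure ((S' : Set K') ∪ (tK : Set K'))) O') := by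
    rw [← hT₂, ← StableRestrict.isRegularLocalRing_locAtCentre_comap_iff O' KT]
    exact hregK
  have htKsub : (tK : Set K') ⊆ Set.range (algebraMap K K' : K →+* K') := by
    intro w hw
    obtain ⟨w', hw', rfl⟩ := Finset.mem_image.mp (Finset.mem_coe.mp hw)
    have h1 : w' ∈ K₀ := (Subring.mem_inf.mp (ht''sub (Finset.mem_coe.mpr hw'))).2
    exact exists_algebraMap_eq_of_fixed_all fun g => (hK₀ w').mp h1 g
  have hT₂O : Subring.closure ((S' : Set K') ∪ (tK : Set K')) ≤ O'.toSubring := by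
    rw [← hT₂]
    intro w hw
    obtain ⟨w', hw', rfl⟩ := Subring.mem_map.mp hw
    exact hT₁O ((hmemS w').mp (Subring.mem_inf.mp hw').1)
  exact ⟨tK, htKsub, hT₂O, hT₂reg⟩

end Law

end Summit.ResolutionOfSingularities.ResolutionOfSingularities.Theorems.TameTwoStoreyLU

end
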